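/-
Copyright (c) 2026. All rights reserved.
Released under Apache 2.0 license as described in the file LICENSE.
-/
import Mathlib
import HarnessLib
import Literature.Topology.FourManifolds.TubeFramings
import Literature.Topology.FourManifolds.Isotopy

/-!
# Loops of circles: inserting the trace annulus into a bounding disc, and the drag identity

Topic `Literature/Topology/FourManifolds`. Module G of the proof of the fact
`Literature.Topology.FourManifolds.exists_middleLevel_isStabilization_of_isHCobordism` (Kirby 1989,
Ch. X pp. 55–56): the algebra of extension classes (`StableFrames.eClass`,
`StableFramesAlongDiscs.lean`; `CircleNbhd.ob`, `TubeFramings.lean`) needed to change the framing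
class of an attaching circle by **dragging it around a loop of circles** (Kirby's odd case,
p. 56 with Cor. I.4.6), with no transversality and no bundle theory beyond the tree's covering
homotopy theorem:

* §1–§2 radial reparametrisations of the disc and the disc `insert(A, X)` obtained from a disc `X`
  by inserting an annulus `A : ℝ × 𝕊¹ → M` (times `[0, 1]`) in front of it, jointly continuous in
  families (`continuous_insertFun`).
* §3 families of glued spheres are homotopies (`glueHomotopy`), so framings transfer along them
  (`framed_glue_iff_of_family`, from `HasStableTangentFramingAlong.homotopy`).
* §4 **`eClass_insertDisc_add_eClass`: `e(F, insert A X) + e(F, X)` does not depend on the disc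
  `X`** (slide the equator of `glue (insert A X) (insert A X')` through the annulus to
  `glue (X ∘ g_{1/2}) (X' ∘ g_{1/2}) ≃ glue X X'`), and §4b `eClass_insertDisc_eq_of_family`: homotopic
  annuli (rel the two boundary circles) insert the same class.
* §5 **the drag identity `eClass_compDisc_ambientIsotopy`: for an ambient isotopy `Ψ` with
  `Ψ₁ ∘ γ = γ`, `e(F, Ψ₁ ∘ D) = e(F, insert(trace Ψ γ, D))`** (the discs
  `insert(trace|[0,s], Ψ_s ∘ D)` all bound `γ`), and §6 its reading for the class `ob` of a tubular
  neighbourhood of a circle (`CircleNbhd.ob_compDisc_ambientIsotopy`).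

Everything is proved; no named facts are introduced.

## References

* R. C. Kirby, *The topology of 4-manifolds*, LNM 1374 (1989), Ch. X, pp. 55–56; Ch. I, Cor. 4.6. [Kirby1989]
* A. Hatcher, *Algebraic Topology* (2002), Prop. 4.48 (covering homotopy property). [HatcherAT2002]
-/

noncomputable section

open Set Function Metric Topology Bundle
open scoped Topology Manifold ContDiff unitInterval

namespace Literature.Topology.FourManifolds

namespace StableFrames

/-- Local notation: `𝔼 n` is the model Euclidean space `EuclideanSpace ℝ (Fin n)`. -/
local notation "𝔼 " n:arg => EuclideanSpace ℝ (Fin n)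

/-- Local notation: the unit circle. -/
local notation "𝕊¹" => (sphere (0 : EuclideanSpace ℝ (Fin (1 + 1))) 1)

/-- Local notation: the closed unit disc in the plane. -/
local notation "𝔻²" => UnitDisc2

/-- Local notation: the unit `2`-sphere. -/
local notation "𝕊²" => (sphere (0 : EuclideanSpace ℝ (Fin (2 + 1))) 1)

/-! ### 1. Radial reparametrisations of the disc -/

section Radial

/-- The **direction** of a point of the disc (a point of the circle; junk `(1, 0)` at the centre).
[folklore] -/
def dir2 (x : 𝔻²) : 𝕊¹ :=
  if h : (x : EuclideanSpace ℝ (Fin (1 + 1))) = 0 then ⟨EuclideanSpace.single 0 1, by simp⟩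
  else ⟨‖(x : EuclideanSpace ℝ (Fin (1 + 1)))‖⁻¹ • (x : EuclideanSpace ℝ (Fin (1 + 1))), by
    rw [mem_sphere_zero_iff_norm, norm_smul, norm_inv, norm_norm, inv_mul_cancel₀ (norm_ne_zero_iff.mpr h)]⟩

/-- The direction off the centre. [folklore] -/
theorem dir2_val {x : 𝔻²} (h : (x : EuclideanSpace ℝ (Fin (1 + 1))) ≠ 0) :
    ((dir2 x : 𝕊¹) : EuclideanSpace ℝ (Fin (1 + 1))) = ‖(x : EuclideanSpace ℝ (Fin (1 + 1)))‖⁻¹ • (x : EuclideanSpace ℝ (Fin (1 + 1))) := by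
  rw [dir2, dif_neg h]

/-- The direction of a boundary point is itself. [folklore] -/
@[simp] theorem dir2_bd (u : 𝕊¹) : dir2 (bd u) = u := by
  have hu : ‖(u : EuclideanSpace ℝ (Fin (1 + 1)))‖ = 1 := norm_eq_of_mem_sphere u
  have h0 : ((bd u : 𝔻²) : EuclideanSpace ℝ (Fin (1 + 1))) ≠ 0 := by
    change (u : EuclideanSpace ℝ (Fin (1 + 1))) ≠ 0
    rw [← norm_ne_zero_iff, hu]; exact one_ne_zero
  apply Subtype.ext
  rw [dir2_val h0]
  change ‖(u : EuclideanSpace ℝ (Fin (1 + 1)))‖⁻¹ • (u : EuclideanSpace ℝ (Fin (1 + 1))) = u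
  rw [hu, inv_one, one_smul]

/-- The direction is continuous off the centre. [folklore] -/
theorem continuousOn_dir2 : ContinuousOn dir2 {x : 𝔻² | (x : EuclideanSpace ℝ (Fin (1 + 1))) ≠ 0} := by
  rw [Topology.IsEmbedding.subtypeVal.continuousOn_iff]
  have h : ContinuousOn (fun x : 𝔻² => ‖(x : EuclideanSpace ℝ (Fin (1 + 1)))‖⁻¹ • (x : EuclideanSpace ℝ (Fin (1 + 1))))
      {x : 𝔻² | (x : EuclideanSpace ℝ (Fin (1 + 1))) ≠ 0} :=
    ((continuous_subtype_val.norm).continuousOn.inv₀ fun x hx => norm_ne_zero_iff.mpr hx).smul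
      continuous_subtype_val.continuousOn
  exact h.congr fun x hx => dir2_val hx

/-- **The radial reparametrisation `g_ρ`**: `x ↦ x/ρ` on the disc of radius `ρ`, radial
projection to the boundary outside it (`ρ ∈ [1/2, 1]`; for `ρ = 1` the identity, for `ρ = 1/2` the
doubling followed by the collapse of the outer annulus onto the boundary). [folklore] -/
def radial (ρ : ℝ) (x : 𝔻²) : EuclideanSpace ℝ (Fin (1 + 1)) :=
  if ‖(x : EuclideanSpace ℝ (Fin (1 + 1)))‖ ≤ ρ then ρ⁻¹ • (x : EuclideanSpace ℝ (Fin (1 + 1)))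
  else ‖(x : EuclideanSpace ℝ (Fin (1 + 1)))‖⁻¹ • (x : EuclideanSpace ℝ (Fin (1 + 1)))

/-- The radial reparametrisation stays in the disc (`0 < ρ`). [folklore] -/
theorem norm_radial_le {ρ : ℝ} (hρ : 0 < ρ) (x : 𝔻²) : ‖radial ρ x‖ ≤ 1 := by
  unfold radial
  split_ifs with h
  · rw [norm_smul, norm_inv, Real.norm_of_nonneg hρ.le, inv_mul_le_iff₀ hρ, mul_one]
    exact h
  · have hx : ‖(x : EuclideanSpace ℝ (Fin (1 + 1)))‖ ≠ 0 := by
      intro h0; rw [h0] at h; exact h hρ.le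
    rw [norm_smul, norm_inv, norm_norm, inv_mul_cancel₀ hx]

/-- The radial reparametrisation as a self-map of the disc. [folklore] -/
def radialD (ρ : ℝ) (hρ : 0 < ρ) (x : 𝔻²) : 𝔻² := ⟨radial ρ x, mem_closedBall_zero_iff.mpr (norm_radial_le hρ x)⟩

/-- **Joint continuity of the radial reparametrisations** in `(ρ, x)` for a continuous positive
radius function. [folklore] -/
theorem continuous_radial {Z : Type*} [TopologicalSpace Z] {ρ : Z → ℝ} (hρc : Continuous ρ) (hρ : ∀ z, 0 < ρ z) :
    Continuous fun p : Z × 𝔻² => radial (ρ p.1) p.2 := by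
  have hval : Continuous fun p : Z × 𝔻² => ((p.2 : 𝔻²) : EuclideanSpace ℝ (Fin (1 + 1))) :=
    continuous_subtype_val.comp continuous_snd
  have hnorm : Continuous fun p : Z × 𝔻² => ‖((p.2 : 𝔻²) : EuclideanSpace ℝ (Fin (1 + 1)))‖ := hval.norm
  have hρ' : Continuous fun p : Z × 𝔻² => ρ p.1 := hρc.comp continuous_fst
  unfold radial
  refine continuous_if_le hnorm hρ' ?_ ?_ ?_
  · exact ((hρ'.inv₀ fun p => (hρ p.1).ne').smul hval).continuousOn
  · refine ContinuousOn.smul (hnorm.continuousOn.inv₀ fun p hp => ?_) hval.continuousOn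
    have hp' : ρ p.1 ≤ ‖((p.2 : 𝔻²) : EuclideanSpace ℝ (Fin (1 + 1)))‖ := hp
    exact ((hρ p.1).trans_le hp').ne'
  · intro p hp
    rw [show ‖((p.2 : 𝔻²) : EuclideanSpace ℝ (Fin (1 + 1)))‖ = ρ p.1 from hp]

/-- `0 < 1/2`. [folklore] -/
theorem inv_two_pos' : (0 : ℝ) < 2⁻¹ := by norm_num

/-- **The doubling** `g_{1/2}`: `x ↦ 2x` on the inner half disc, radial projection to the
boundary on the outer annulus. [folklore] -/
def halfRadial (x : 𝔻²) : 𝔻² := radialD 2⁻¹ inv_two_pos' x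

/-- The doubling is continuous. [folklore] -/
theorem continuous_halfRadial : Continuous halfRadial := by
  have h1 := continuous_radial (Z := Unit) (ρ := fun _ => (2⁻¹ : ℝ)) continuous_const fun _ => inv_two_pos'
  have h2 : Continuous fun x : 𝔻² => (((), x) : Unit × 𝔻²) := (continuous_const (y := ())).prodMk continuous_id
  exact (h1.comp h2).subtype_mk _

/-- On the boundary circle the radial reparametrisation is the identity (`ρ ≤ 1`). [folklore] -/
theorem radial_bd {ρ : ℝ} (hρ1 : ρ ≤ 1) (u : 𝕊¹) : radial ρ (bd u) = u := by
  have hu : ‖(u : EuclideanSpace ℝ (Fin (1 + 1)))‖ = 1 := norm_eq_of_mem_sphere u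
  unfold radial
  change (if ‖(u : EuclideanSpace ℝ (Fin (1 + 1)))‖ ≤ ρ then ρ⁻¹ • (u : EuclideanSpace ℝ (Fin (1 + 1)))
    else ‖(u : EuclideanSpace ℝ (Fin (1 + 1)))‖⁻¹ • (u : EuclideanSpace ℝ (Fin (1 + 1)))) = u
  rw [hu]
  split_ifs with h
  · have : ρ = 1 := le_antisymm hρ1 h
    rw [this, inv_one, one_smul]
  · rw [inv_one, one_smul]

/-- The radial reparametrisation with `ρ = 1` is the identity. [folklore] -/
theorem radial_one (x : 𝔻²) : radial 1 x = x := by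
  unfold radial
  rw [if_pos (mem_closedBall_zero_iff.mp x.2), inv_one, one_smul]

end Radial

/-! ### 2. Inserting an annulus in front of a disc -/

section Insert

variable {M : Type*} [TopologicalSpace M]

/-- **The disc obtained by inserting the annulus `A : ℝ × 𝕊¹ → M` (times `t ∈ [0, 1]`) in front
of the disc `X`**: the outer annulus `1/2 ≤ ‖x‖ ≤ 1` carries `A` (time `2 - 2‖x‖`, from `A(0, ·)`
on the boundary circle to `A(1, ·) = X ∘ bd` on the middle circle), the inner disc carries `X`
at double speed. [folklore] -/
def insertFun (A : ℝ × 𝕊¹ → M) (X : 𝔻² → M) (x : 𝔻²) : M :=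
  if ‖(x : EuclideanSpace ℝ (Fin (1 + 1)))‖ ≤ 2⁻¹ then X (halfRadial x)
  else A (2 - 2 * ‖(x : EuclideanSpace ℝ (Fin (1 + 1)))‖, dir2 x)

/-- **Joint continuity of the insertion** in families: if `(z, t, u) ↦ A_z(t, u)` and
`(z, x) ↦ X_z(x)` are continuous and `A_z(1, ·) = X_z ∘ bd`, then `(z, x) ↦ insert(A_z, X_z)(x)` is
continuous. [folklore] -/
theorem continuous_insertFun {Z : Type*} [TopologicalSpace Z] {A : Z → ℝ × 𝕊¹ → M} {X : Z → 𝔻² → M}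
    (hA : Continuous fun p : Z × (ℝ × 𝕊¹) => A p.1 p.2) (hX : Continuous fun p : Z × 𝔻² => X p.1 p.2)
    (hAX : ∀ z u, A z (1, u) = X z (bd u)) :
    Continuous fun p : Z × 𝔻² => insertFun (A p.1) (X p.1) p.2 := by
  have hval : Continuous fun p : Z × 𝔻² => ((p.2 : 𝔻²) : EuclideanSpace ℝ (Fin (1 + 1))) :=
    continuous_subtype_val.comp continuous_snd
  have hnorm : Continuous fun p : Z × 𝔻² => ‖((p.2 : 𝔻²) : EuclideanSpace ℝ (Fin (1 + 1)))‖ := hval.norm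
  -- the inner branch
  have hin : Continuous fun p : Z × 𝔻² => X p.1 (halfRadial p.2) :=
    hX.comp (continuous_fst.prodMk (continuous_halfRadial.comp continuous_snd))
  -- the outer branch, on `{1/2 ≤ ‖x‖}`
  have hne : ∀ p : Z × 𝔻², (2⁻¹ : ℝ) ≤ ‖((p.2 : 𝔻²) : EuclideanSpace ℝ (Fin (1 + 1)))‖ →
      ((p.2 : 𝔻²) : EuclideanSpace ℝ (Fin (1 + 1))) ≠ 0 := fun p hp h0 => by
    rw [h0, norm_zero] at hp; norm_num at hp
  have hdir : ContinuousOn (fun p : Z × 𝔻² => dir2 p.2) {p | (2⁻¹ : ℝ) ≤ ‖((p.2 : 𝔻²) : EuclideanSpace ℝ (Fin (1 + 1)))‖} :=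
    continuousOn_dir2.comp continuous_snd.continuousOn fun p hp => hne p hp
  have htime : Continuous fun p : Z × 𝔻² => (2 : ℝ) - 2 * ‖((p.2 : 𝔻²) : EuclideanSpace ℝ (Fin (1 + 1)))‖ :=
    continuous_const.sub (continuous_const.mul hnorm)
  have hout : ContinuousOn (fun p : Z × 𝔻² => A p.1 (2 - 2 * ‖((p.2 : 𝔻²) : EuclideanSpace ℝ (Fin (1 + 1)))‖, dir2 p.2))
      {p | (2⁻¹ : ℝ) ≤ ‖((p.2 : 𝔻²) : EuclideanSpace ℝ (Fin (1 + 1)))‖} :=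
    hA.comp_continuousOn (continuousOn_fst.prodMk (htime.continuousOn.prodMk hdir))
  unfold insertFun
  refine continuous_if_le hnorm continuous_const hin.continuousOn hout fun p hp => ?_
  have hp' : ‖((p.2 : 𝔻²) : EuclideanSpace ℝ (Fin (1 + 1)))‖ = 2⁻¹ := hp
  have hne' : ((p.2 : 𝔻²) : EuclideanSpace ℝ (Fin (1 + 1))) ≠ 0 := hne p hp'.ge
  have h1 : (2 : ℝ) - 2 * ‖((p.2 : 𝔻²) : EuclideanSpace ℝ (Fin (1 + 1)))‖ = 1 := by rw [hp']; norm_num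
  rw [h1, hAX]
  congr 1
  apply Subtype.ext
  change radial 2⁻¹ p.2 = ((dir2 p.2 : 𝕊¹) : EuclideanSpace ℝ (Fin (1 + 1)))
  rw [dir2_val hne', radial, if_pos hp'.le, hp']

/-- Continuity of a single insertion. [folklore] -/
theorem continuous_insertFun₁ {A : ℝ × 𝕊¹ → M} {X : 𝔻² → M} (hA : Continuous A) (hX : Continuous X)
    (hAX : ∀ u, A (1, u) = X (bd u)) : Continuous (insertFun A X) := by
  have hval : Continuous fun x : 𝔻² => (x : EuclideanSpace ℝ (Fin (1 + 1))) := continuous_subtype_val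
  have hnorm : Continuous fun x : 𝔻² => ‖(x : EuclideanSpace ℝ (Fin (1 + 1)))‖ := hval.norm
  have hin : Continuous fun x : 𝔻² => X (halfRadial x) := hX.comp continuous_halfRadial
  have hne : ∀ x : 𝔻², (2⁻¹ : ℝ) ≤ ‖(x : EuclideanSpace ℝ (Fin (1 + 1)))‖ → (x : EuclideanSpace ℝ (Fin (1 + 1))) ≠ 0 :=
    fun x hx h0 => by rw [h0, norm_zero] at hx; norm_num at hx
  have hdir : ContinuousOn dir2 {x : 𝔻² | (2⁻¹ : ℝ) ≤ ‖(x : EuclideanSpace ℝ (Fin (1 + 1)))‖} :=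
    continuousOn_dir2.mono fun x hx => hne x hx
  have htime : Continuous fun x : 𝔻² => (2 : ℝ) - 2 * ‖(x : EuclideanSpace ℝ (Fin (1 + 1)))‖ :=
    continuous_const.sub (continuous_const.mul hnorm)
  have hout : ContinuousOn (fun x : 𝔻² => A (2 - 2 * ‖(x : EuclideanSpace ℝ (Fin (1 + 1)))‖, dir2 x))
      {x : 𝔻² | (2⁻¹ : ℝ) ≤ ‖(x : EuclideanSpace ℝ (Fin (1 + 1)))‖} :=
    hA.comp_continuousOn (htime.continuousOn.prodMk hdir)
  unfold insertFun
  refine continuous_if_le hnorm continuous_const hin.continuousOn hout fun x hx => ?_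
  have hx' : ‖(x : EuclideanSpace ℝ (Fin (1 + 1)))‖ = 2⁻¹ := hx
  have hne' : (x : EuclideanSpace ℝ (Fin (1 + 1))) ≠ 0 := hne x hx'.ge
  have h1 : (2 : ℝ) - 2 * ‖(x : EuclideanSpace ℝ (Fin (1 + 1)))‖ = 1 := by rw [hx']; norm_num
  rw [h1, hAX]
  congr 1
  apply Subtype.ext
  change radial 2⁻¹ x = ((dir2 x : 𝕊¹) : EuclideanSpace ℝ (Fin (1 + 1)))
  rw [dir2_val hne', radial, if_pos hx'.le, hx']

/-- The insertion as a continuous disc. [folklore] -/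
def insertDisc (A : C(ℝ × 𝕊¹, M)) (X : C(𝔻², M)) (hAX : ∀ u, A (1, u) = X (bd u)) : C(𝔻², M) :=
  ⟨insertFun A X, continuous_insertFun₁ A.continuous X.continuous hAX⟩

/-- The boundary of the inserted disc is the front circle `A(0, ·)`. [folklore] -/
theorem insertDisc_bd (A : C(ℝ × 𝕊¹, M)) (X : C(𝔻², M)) (hAX : ∀ u, A (1, u) = X (bd u)) (u : 𝕊¹) :
    insertDisc A X hAX (bd u) = A (0, u) := by
  have hu : ‖(u : EuclideanSpace ℝ (Fin (1 + 1)))‖ = 1 := norm_eq_of_mem_sphere u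
  change insertFun A X (bd u) = A (0, u)
  unfold insertFun
  have : ¬ ‖((bd u : 𝔻²) : EuclideanSpace ℝ (Fin (1 + 1)))‖ ≤ 2⁻¹ := by
    change ¬ ‖(u : EuclideanSpace ℝ (Fin (1 + 1)))‖ ≤ 2⁻¹
    rw [hu]; norm_num
  rw [if_neg this, dir2_bd]
  change A (2 - 2 * ‖(u : EuclideanSpace ℝ (Fin (1 + 1)))‖, u) = A (0, u)
  rw [hu]; norm_num

/-- **Inserting a constant annulus is the radial reparametrisation**: if `A(t, u) = X (bd u)` for
all `t`, then `insert(A, X) = X ∘ g_{1/2}`. [folklore] -/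
theorem insertDisc_const_apply (A : C(ℝ × 𝕊¹, M)) (X : C(𝔻², M)) (hA : ∀ t u, A (t, u) = X (bd u)) (x : 𝔻²) :
    insertDisc A X (fun u => hA 1 u) x = X (halfRadial x) := by
  change insertFun A X x = _
  unfold insertFun
  split_ifs with h
  · rfl
  · have hne : (x : EuclideanSpace ℝ (Fin (1 + 1))) ≠ 0 := by
      intro h0; rw [h0, norm_zero] at h; norm_num at h
    rw [hA]
    congr 1
    apply Subtype.ext
    change ((dir2 x : 𝕊¹) : EuclideanSpace ℝ (Fin (1 + 1))) = radial 2⁻¹ x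
    rw [dir2_val hne, radial, if_neg h]

end Insert

/-! ### 3. Families of glued spheres and the transfer of framings -/

section GlueFamily

variable {M : Type*} [TopologicalSpace M]

/-- The glued sphere as a plain function (the formula of `StableFrames.glue`). [folklore] -/
def glueFun (D₁ D₂ : 𝔻² → M) (p : 𝕊²) : M := if 0 ≤ p.1 2 then D₁ (projD p) else D₂ (projD p)

/-- `glue` is `glueFun`. [folklore] -/
theorem glue_apply (D₁ D₂ : C(𝔻², M)) (h : ∀ u, D₁ (bd u) = D₂ (bd u)) (p : 𝕊²) : glue D₁ D₂ h p = glueFun D₁ D₂ p := rfl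

/-- **Joint continuity of glued families.** [folklore] -/
theorem continuous_glueFun {Z : Type*} [TopologicalSpace Z] {D₁ D₂ : Z → 𝔻² → M}
    (h₁ : Continuous fun p : Z × 𝔻² => D₁ p.1 p.2) (h₂ : Continuous fun p : Z × 𝔻² => D₂ p.1 p.2)
    (hbd : ∀ z u, D₁ z (bd u) = D₂ z (bd u)) :
    Continuous fun p : Z × 𝕊² => glueFun (D₁ p.1) (D₂ p.1) p.2 := by
  unfold glueFun
  refine continuous_if_le continuous_const ((continuous_sphere_coord 2).comp continuous_snd) ?_ ?_ fun p hp => ?_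
  · exact (h₁.comp (continuous_fst.prodMk (continuous_projD.comp continuous_snd))).continuousOn
  · exact (h₂.comp (continuous_fst.prodMk (continuous_projD.comp continuous_snd))).continuousOn
  · obtain ⟨u, hu⟩ := projD_eq_bd (p := p.2) hp.symm
    rw [hu]; exact hbd _ _

/-- **A family of pairs of discs with common boundaries is a homotopy of the glued spheres.**
[folklore] -/
def glueHomotopy {D₁ D₂ : I → C(𝔻², M)}
    (h₁ : Continuous fun p : I × 𝔻² => D₁ p.1 p.2) (h₂ : Continuous fun p : I × 𝔻² => D₂ p.1 p.2)
    (hbd : ∀ s u, D₁ s (bd u) = D₂ s (bd u)) :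
    ContinuousMap.Homotopy (glue (D₁ 0) (D₂ 0) (hbd 0)) (glue (D₁ 1) (D₂ 1) (hbd 1)) where
  toFun p := glueFun (D₁ p.1) (D₂ p.1) p.2
  continuous_toFun := continuous_glueFun h₁ h₂ hbd
  map_zero_left _ := rfl
  map_one_left _ := rfl

variable {m : ℕ} [ChartedSpace (𝔼 m) M] [IsManifold (𝓡 m) 1 M]

/-- Rewriting the discs of a glued sphere. [folklore] -/
theorem framed_glue_congr {D₁ D₁' D₂ D₂' : C(𝔻², M)} (e₁ : D₁ = D₁') (e₂ : D₂ = D₂')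
    (h : ∀ u, D₁ (bd u) = D₂ (bd u)) (h' : ∀ u, D₁' (bd u) = D₂' (bd u)) :
    HasStableTangentFramingAlong (𝓡 m) M (glue D₁ D₂ h) ↔ HasStableTangentFramingAlong (𝓡 m) M (glue D₁' D₂' h') := by
  subst e₁ e₂; exact Iff.rfl

/-- **Framings transfer along families of glued spheres** (covering homotopy theorem, the tree's
`HasStableTangentFramingAlong.homotopy`). [folklore] -/
theorem framed_glue_of_family {D₁ D₂ : I → C(𝔻², M)}
    (h₁ : Continuous fun p : I × 𝔻² => D₁ p.1 p.2) (h₂ : Continuous fun p : I × 𝔻² => D₂ p.1 p.2)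
    (hbd : ∀ s u, D₁ s (bd u) = D₂ s (bd u))
    (h : HasStableTangentFramingAlong (𝓡 m) M (glue (D₁ 0) (D₂ 0) (hbd 0))) :
    HasStableTangentFramingAlong (𝓡 m) M (glue (D₁ 1) (D₂ 1) (hbd 1)) := by
  set H := glueHomotopy h₁ h₂ hbd with hH
  have e0 : (fun y => H.toContinuousMap (0, y)) = glue (D₁ 0) (D₂ 0) (hbd 0) := funext fun y => H.map_zero_left y
  have e1 : (fun y => H.toContinuousMap (1, y)) = glue (D₁ 1) (D₂ 1) (hbd 1) := funext fun y => H.map_one_left y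
  have h' := HasStableTangentFramingAlong.homotopy (m := m) H.toContinuousMap (by rw [e0]; exact h)
  rwa [e1] at h'

/-- The transfer in both directions. [folklore] -/
theorem framed_glue_iff_of_family {D₁ D₂ : I → C(𝔻², M)}
    (h₁ : Continuous fun p : I × 𝔻² => D₁ p.1 p.2) (h₂ : Continuous fun p : I × 𝔻² => D₂ p.1 p.2)
    (hbd : ∀ s u, D₁ s (bd u) = D₂ s (bd u)) :
    HasStableTangentFramingAlong (𝓡 m) M (glue (D₁ 0) (D₂ 0) (hbd 0)) ↔
      HasStableTangentFramingAlong (𝓡 m) M (glue (D₁ 1) (D₂ 1) (hbd 1)) := by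
  refine ⟨framed_glue_of_family h₁ h₂ hbd, fun h => ?_⟩
  -- the reversed family
  have h₁' : Continuous fun p : I × 𝔻² => D₁ (unitInterval.symm p.1) p.2 :=
    h₁.comp ((unitInterval.continuous_symm.comp continuous_fst).prodMk continuous_snd)
  have h₂' : Continuous fun p : I × 𝔻² => D₂ (unitInterval.symm p.1) p.2 :=
    h₂.comp ((unitInterval.continuous_symm.comp continuous_fst).prodMk continuous_snd)
  have key := framed_glue_of_family (m := m) (D₁ := fun s => D₁ (unitInterval.symm s)) (D₂ := fun s => D₂ (unitInterval.symm s))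
    h₁' h₂' (fun s u => hbd _ u)
    ((framed_glue_congr (congrArg D₁ unitInterval.symm_zero) (congrArg D₂ unitInterval.symm_zero) _ (hbd 1)).mpr h)
  exact (framed_glue_congr (congrArg D₁ unitInterval.symm_one) (congrArg D₂ unitInterval.symm_one) _ (hbd 0)).mp key

end GlueFamily

/-! ### 4. The class of an inserted annulus does not depend on the disc -/

section Tau

variable {m : ℕ} {M : Type*} [TopologicalSpace M] [ChartedSpace (𝔼 m) M] [IsManifold (𝓡 m) 1 M]

/-- The sliding annuli `A^s(t, u) = A(s + (1 - s) t, u)`. [folklore] -/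
def slide (A : C(ℝ × 𝕊¹, M)) (s : I) : C(ℝ × 𝕊¹, M) :=
  ⟨fun q => A ((s : ℝ) + (1 - (s : ℝ)) * q.1, q.2), A.continuous.comp
    ((continuous_const.add (continuous_const.mul continuous_fst)).prodMk continuous_snd)⟩

/-- The sliding annuli end on `A(1, ·)`. [folklore] -/
theorem slide_one (A : C(ℝ × 𝕊¹, M)) (s : I) (u : 𝕊¹) : slide A s (1, u) = A (1, u) := by
  change A ((s : ℝ) + (1 - (s : ℝ)) * 1, u) = A (1, u)
  ring_nf

/-- The sliding annuli are jointly continuous. [folklore] -/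
theorem continuous_slide (A : C(ℝ × 𝕊¹, M)) : Continuous fun p : I × (ℝ × 𝕊¹) => slide A p.1 p.2 :=
  A.continuous.comp ((((continuous_subtype_val.comp continuous_fst)).add
    ((continuous_const.sub (continuous_subtype_val.comp continuous_fst)).mul (continuous_fst.comp continuous_snd))).prodMk
    (continuous_snd.comp continuous_snd))

omit [ChartedSpace (𝔼 m) M] [IsManifold (𝓡 m) 1 M] in
/-- At `s = 0` the sliding annulus is `A`. [folklore] -/
theorem slide_zero (A : C(ℝ × 𝕊¹, M)) : slide A 0 = A := by
  ext q; change A ((0 : ℝ) + (1 - 0) * q.1, q.2) = A q; ring_nf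

omit [ChartedSpace (𝔼 m) M] [IsManifold (𝓡 m) 1 M] in
/-- At `s = 1` the sliding annulus is constant in time. [folklore] -/
theorem slide_one_apply (A : C(ℝ × 𝕊¹, M)) (t : ℝ) (u : 𝕊¹) : slide A 1 (t, u) = A (1, u) := by
  change A ((1 : ℝ) + (1 - 1) * t, u) = A (1, u); ring_nf

/-- The radius family `ρ_r = (1 + r)/2`. [folklore] -/
def rho (r : I) : ℝ := (1 + (r : ℝ)) / 2

omit [ChartedSpace (𝔼 m) M] [IsManifold (𝓡 m) 1 M] in
/-- `ρ_r > 0`. [folklore] -/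
theorem rho_pos (r : I) : 0 < rho r := by unfold rho; linarith [r.2.1]

omit [ChartedSpace (𝔼 m) M] [IsManifold (𝓡 m) 1 M] in
/-- `ρ_r ≤ 1`. [folklore] -/
theorem rho_le_one (r : I) : rho r ≤ 1 := by unfold rho; linarith [r.2.2]

/-- **The doubling is homotopic to the identity through the radial reparametrisations**, so
`glue (X ∘ g_{1/2}) (X' ∘ g_{1/2})` is framed iff `glue X X'` is. [folklore] -/
theorem framed_glue_halfRadial_iff (X X' : C(𝔻², M)) (h : ∀ u, X (bd u) = X' (bd u)) :
    HasStableTangentFramingAlong (𝓡 m) M (glue (X.comp ⟨halfRadial, continuous_halfRadial⟩)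
        (X'.comp ⟨halfRadial, continuous_halfRadial⟩) fun u => by
          change X (halfRadial (bd u)) = X' (halfRadial (bd u))
          have : halfRadial (bd u) = bd u := Subtype.ext (radial_bd (by norm_num) u)
          rw [this]; exact h u) ↔
      HasStableTangentFramingAlong (𝓡 m) M (glue X X' h) := by
  -- the radial family
  set R : I → C(𝔻², 𝔻²) := fun r => ⟨radialD (rho r) (rho_pos r), by
    have h1 := continuous_radial (Z := Unit) (ρ := fun _ => rho r) continuous_const fun _ => rho_pos r
    have h2 : Continuous fun x : 𝔻² => (((), x) : Unit × 𝔻²) := (continuous_const (y := ())).prodMk continuous_id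
    exact (h1.comp h2).subtype_mk _⟩ with hR
  have hRc : Continuous fun p : I × 𝔻² => R p.1 p.2 := by
    have h1 := continuous_radial (Z := I) (ρ := rho) (by unfold rho; fun_prop) rho_pos
    exact h1.subtype_mk _
  have hRbd : ∀ r u, R r (bd u) = bd u := fun r u => Subtype.ext (radial_bd (rho_le_one r) u)
  have key := framed_glue_iff_of_family (m := m) (D₁ := fun r => X.comp (R r)) (D₂ := fun r => X'.comp (R r))
    (X.continuous.comp hRc) (X'.continuous.comp hRc) fun r u => by
      change X (R r (bd u)) = X' (R r (bd u)); rw [hRbd]; exact h u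
  -- identify the ends
  have h0 : ∀ x, R 0 x = halfRadial x := fun x => by
    apply Subtype.ext
    change radial (rho 0) x = radial 2⁻¹ x
    rw [show rho 0 = 2⁻¹ by unfold rho; norm_num]
  have h1 : ∀ x, R 1 x = x := fun x => by
    apply Subtype.ext
    change radial (rho 1) x = x
    rw [show rho 1 = 1 by unfold rho; norm_num]; exact radial_one x
  have e0X : X.comp (R 0) = X.comp ⟨halfRadial, continuous_halfRadial⟩ := ContinuousMap.ext fun x => congrArg X (h0 x)
  have e0X' : X'.comp (R 0) = X'.comp ⟨halfRadial, continuous_halfRadial⟩ := ContinuousMap.ext fun x => congrArg X' (h0 x)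
  have e1X : X.comp (R 1) = X := ContinuousMap.ext fun x => congrArg X (h1 x)
  have e1X' : X'.comp (R 1) = X' := ContinuousMap.ext fun x => congrArg X' (h1 x)
  exact ((framed_glue_congr e0X e0X' _ _).symm.trans key).trans (framed_glue_congr e1X e1X' _ _)

/-- **Sliding the equator through the annulus**: `glue (insert A X) (insert A X')` is framed iff
`glue X X'` is. [folklore] -/
theorem framed_glue_insertDisc_iff (A : C(ℝ × 𝕊¹, M)) (X X' : C(𝔻², M))
    (hX : ∀ u, A (1, u) = X (bd u)) (hX' : ∀ u, A (1, u) = X' (bd u)) :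
    HasStableTangentFramingAlong (𝓡 m) M (glue (insertDisc A X hX) (insertDisc A X' hX')
        fun u => by rw [insertDisc_bd, insertDisc_bd]) ↔
      HasStableTangentFramingAlong (𝓡 m) M (glue X X' fun u => (hX u).symm.trans (hX' u)) := by
  -- the sliding family
  have hsX : ∀ (s : I) u, slide A s (1, u) = X (bd u) := fun s u => by rw [slide_one]; exact hX u
  have hsX' : ∀ (s : I) u, slide A s (1, u) = X' (bd u) := fun s u => by rw [slide_one]; exact hX' u
  have hc : ∀ (Y : C(𝔻², M)) (hY : ∀ (s : I) u, slide A s (1, u) = Y (bd u)),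
      Continuous fun p : I × 𝔻² => insertDisc (slide A p.1) Y (hY p.1) p.2 := fun Y hY =>
    continuous_insertFun (Z := I) (A := fun s => slide A s) (X := fun _ => Y) (continuous_slide A)
      (Y.continuous.comp continuous_snd) hY
  have key := framed_glue_iff_of_family (m := m) (D₁ := fun s => insertDisc (slide A s) X (hsX s))
    (D₂ := fun s => insertDisc (slide A s) X' (hsX' s)) (hc X hsX) (hc X' hsX') fun s u => by
      rw [insertDisc_bd, insertDisc_bd]
  -- ends: `s = 0` is the original pair, `s = 1` the doubled discs
  have e0 : ∀ (Y : C(𝔻², M)) (h₁ : ∀ u, slide A 0 (1, u) = Y (bd u)) (h₂ : ∀ u, A (1, u) = Y (bd u)),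
      insertDisc (slide A 0) Y h₁ = insertDisc A Y h₂ := fun Y h₁ h₂ => ContinuousMap.ext fun x => by
    change insertFun (slide A 0) Y x = insertFun A Y x
    rw [slide_zero]
  have hXc : ∀ t u, slide A 1 (t, u) = X (bd u) := fun t u => by rw [slide_one_apply]; exact hX u
  have hX'c : ∀ t u, slide A 1 (t, u) = X' (bd u) := fun t u => by rw [slide_one_apply]; exact hX' u
  have e1 : ∀ (Y : C(𝔻², M)) (hY : ∀ t u, slide A 1 (t, u) = Y (bd u)),
      insertDisc (slide A 1) Y (fun u => hY 1 u) = Y.comp ⟨halfRadial, continuous_halfRadial⟩ := fun Y hY =>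
    ContinuousMap.ext fun x => insertDisc_const_apply _ _ hY x
  exact ((framed_glue_congr (e0 X (hsX 0) hX) (e0 X' (hsX' 0) hX') _ _).symm.trans key).trans
    ((framed_glue_congr (e1 X hXc) (e1 X' hX'c) _ _).trans
      (framed_glue_halfRadial_iff X X' fun u => (hX u).symm.trans (hX' u)))

/-- **The class of an inserted annulus.**  For an annulus `A` with `A(0, ·) = A(1, ·) = γ`, discs
`X`, `X'` bounding `γ`, and a stable frame `F` along `γ`:
`e(F, insert A X) + e(F, X) = e(F, insert A X') + e(F, X')` — the change of the extension class
caused by inserting `A` does not depend on the disc. [folklore] -/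
theorem eClass_insertDisc_add_eClass (hm : 2 ≤ m) {γ : 𝕊¹ → M} (A : C(ℝ × 𝕊¹, M)) (hA0 : ∀ u, A (0, u) = γ u)
    (hA1 : ∀ u, A (1, u) = γ u) (X X' : C(𝔻², M)) (hX : ∀ u, X (bd u) = γ u) (hX' : ∀ u, X' (bd u) = γ u)
    {F : 𝕊¹ → Fr m} (hF : IsStableFrameFieldOn γ F univ) :
    eClass (insertDisc A X fun u => (hA1 u).trans (hX u).symm) F
        (hF.congr_map fun u _ => by change insertDisc A X _ (bd u) = γ u; rw [insertDisc_bd, hA0]) +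
      eClass X F (hF.congr_map fun u _ => hX u) =
    eClass (insertDisc A X' fun u => (hA1 u).trans (hX' u).symm) F
        (hF.congr_map fun u _ => by change insertDisc A X' _ (bd u) = γ u; rw [insertDisc_bd, hA0]) +
      eClass X' F (hF.congr_map fun u _ => hX' u) := by
  have hF₁ : IsStableFrameFieldOn (insertDisc A X (fun u => (hA1 u).trans (hX u).symm) ∘ bd) F univ :=
    hF.congr_map fun u _ => by change insertDisc A X _ (bd u) = γ u; rw [insertDisc_bd, hA0]
  have hF₂ : IsStableFrameFieldOn (X ∘ bd) F univ := hF.congr_map fun u _ => hX u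
  have k1 := framed_glue_iff hm (insertDisc A X fun u => (hA1 u).trans (hX u).symm)
    (insertDisc A X' fun u => (hA1 u).trans (hX' u).symm) (fun u => by rw [insertDisc_bd, insertDisc_bd]) hF₁
  have k2 := framed_glue_iff hm X X' (fun u => (hX u).trans (hX' u).symm) hF₂
  have k3 := framed_glue_insertDisc_iff (m := m) A X X' (fun u => (hA1 u).trans (hX u).symm) (fun u => (hA1 u).trans (hX' u).symm)
  have key : (eClass (insertDisc A X fun u => (hA1 u).trans (hX u).symm) F hF₁ =
      eClass (insertDisc A X' fun u => (hA1 u).trans (hX' u).symm) F _) ↔ (eClass X F hF₂ = eClass X' F _) :=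
    (k1.symm.trans k3).trans k2
  have : ∀ a b c d : ZMod 2, (a = b ↔ c = d) → a + c = b + d := by decide
  exact this _ _ _ _ key

end Tau

/-! ### 4b. Homotopic annuli insert the same class -/

section TauHomotopy

variable {m : ℕ} {M : Type*} [TopologicalSpace M] [ChartedSpace (𝔼 m) M] [IsManifold (𝓡 m) 1 M]

/-- **Homotopy invariance of the inserted class.**  For a family of annuli `A_s` (jointly
continuous in `(s, t, u)`) all starting on `γ` and all ending on the boundary of the disc `X`,
the discs `insert(A_s, X)` all bound `γ` and have the same extension class:
`e(F, insert A₀ X) = e(F, insert A₁ X)`. [folklore] -/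
theorem eClass_insertDisc_eq_of_family (hm : 2 ≤ m) {γ : 𝕊¹ → M} (A : I → C(ℝ × 𝕊¹, M))
    (hA : Continuous fun p : I × (ℝ × 𝕊¹) => A p.1 p.2) (hA0 : ∀ s u, A s (0, u) = γ u)
    (X : C(𝔻², M)) (hAX : ∀ s u, A s (1, u) = X (bd u)) {F : 𝕊¹ → Fr m} (hF : IsStableFrameFieldOn γ F univ) :
    eClass (insertDisc (A 0) X (hAX 0)) F
        (hF.congr_map fun u _ => by change insertDisc (A 0) X _ (bd u) = γ u; rw [insertDisc_bd, hA0]) =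
      eClass (insertDisc (A 1) X (hAX 1)) F
        (hF.congr_map fun u _ => by change insertDisc (A 1) X _ (bd u) = γ u; rw [insertDisc_bd, hA0]) := by
  set Δ : I → C(𝔻², M) := fun s => insertDisc (A s) X (hAX s) with hΔ
  have hΔbd : ∀ (s : I) u, Δ s (bd u) = γ u := fun s u => by rw [hΔ]; dsimp only; rw [insertDisc_bd, hA0]
  have hΔc : Continuous fun p : I × 𝔻² => Δ p.1 p.2 :=
    continuous_insertFun (Z := I) (A := fun s => A s) (X := fun _ => X) hA (X.continuous.comp continuous_snd) hAX
  have hFΔ : ∀ s : I, IsStableFrameFieldOn (Δ s ∘ bd) F univ := fun s => hF.congr_map fun u _ => hΔbd s u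
  have hfr := (framed_glue_iff_of_family (m := m) (D₁ := fun _ => Δ 0) (D₂ := fun s => Δ s)
    ((Δ 0).continuous.comp continuous_snd) hΔc fun s u => (hΔbd 0 u).trans (hΔbd s u).symm).mp
    (framed_glue_self hm (Δ 0))
  exact (framed_glue_iff hm (Δ 0) (Δ 1) _ (hFΔ 0)).mp hfr

end TauHomotopy

/-! ### 5. The drag identity: transporting a disc along an ambient isotopy that returns the circle -/

section Drag

variable {m : ℕ} {M : Type*} [TopologicalSpace M] [ChartedSpace (𝔼 m) M] [IsManifold (𝓡 m) 1 M]

/-- Rewriting the disc of an extension class. [folklore] -/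
theorem eClass_congr_disc {D D' : C(𝔻², M)} (e : D = D') {F : 𝕊¹ → Fr m} (h : IsStableFrameFieldOn (D ∘ bd) F univ)
    (h' : IsStableFrameFieldOn (D' ∘ bd) F univ) : eClass D F h = eClass D' F h' := by
  subst e; rfl

/-- **The doubled disc has the class of the disc**: `glue (X ∘ g_{1/2}) X` is framed. [folklore] -/
theorem framed_glue_halfRadial_left (hm : 2 ≤ m) (X : C(𝔻², M)) :
    HasStableTangentFramingAlong (𝓡 m) M (glue (X.comp ⟨halfRadial, continuous_halfRadial⟩) X fun u => by
      change X (halfRadial (bd u)) = X (bd u)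
      rw [show halfRadial (bd u) = bd u from Subtype.ext (radial_bd (by norm_num) u)]) := by
  set R : I → C(𝔻², 𝔻²) := fun r => ⟨radialD (rho r) (rho_pos r), by
    have h1 := continuous_radial (Z := Unit) (ρ := fun _ => rho r) continuous_const fun _ => rho_pos r
    have h2 : Continuous fun x : 𝔻² => (((), x) : Unit × 𝔻²) := (continuous_const (y := ())).prodMk continuous_id
    exact (h1.comp h2).subtype_mk _⟩ with hR
  have hRc : Continuous fun p : I × 𝔻² => R p.1 p.2 := by
    have h1 := continuous_radial (Z := I) (ρ := rho) (by unfold rho; fun_prop) rho_pos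
    exact h1.subtype_mk _
  have hRbd : ∀ r u, R r (bd u) = bd u := fun r u => Subtype.ext (radial_bd (rho_le_one r) u)
  have key := framed_glue_iff_of_family (m := m) (D₁ := fun r => X.comp (R r)) (D₂ := fun _ => X)
    (X.continuous.comp hRc) (X.continuous.comp continuous_snd) fun r u => by
      change X (R r (bd u)) = X (bd u); rw [hRbd]
  have h0 : ∀ x, R 0 x = halfRadial x := fun x => by
    apply Subtype.ext
    change radial (rho 0) x = radial 2⁻¹ x
    rw [show rho 0 = 2⁻¹ by unfold rho; norm_num]
  have h1 : ∀ x, R 1 x = x := fun x => by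
    apply Subtype.ext
    change radial (rho 1) x = x
    rw [show rho 1 = 1 by unfold rho; norm_num]; exact radial_one x
  have e0 : X.comp (R 0) = X.comp ⟨halfRadial, continuous_halfRadial⟩ := ContinuousMap.ext fun x => congrArg X (h0 x)
  have e1 : X.comp (R 1) = X := ContinuousMap.ext fun x => congrArg X (h1 x)
  have hend : HasStableTangentFramingAlong (𝓡 m) M (glue (X.comp (R 1)) X fun u => by change X (R 1 (bd u)) = X (bd u); rw [hRbd]) :=
    (framed_glue_congr e1 rfl _ (fun _ => rfl)).mpr (framed_glue_self hm X)
  exact (framed_glue_congr e0 rfl _ _).mp (key.mpr hend)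

/-- **The trace annulus** `(t, u) ↦ Ψ_t(γ(u))` of a circle under an ambient isotopy. [folklore] -/
def traceAnnulus (Ψ : AmbientIsotopy (𝓡 m) M) (γ : C(𝕊¹, M)) : C(ℝ × 𝕊¹, M) :=
  ⟨fun q => Ψ.toFun q.1 (γ q.2), Ψ.contMDiff.continuous.comp (continuous_fst.prodMk (γ.continuous.comp continuous_snd))⟩

omit [IsManifold (𝓡 m) 1 M] in
/-- The trace annulus starts on the circle. [folklore] -/
theorem traceAnnulus_zero (Ψ : AmbientIsotopy (𝓡 m) M) (γ : C(𝕊¹, M)) (u : 𝕊¹) : traceAnnulus Ψ γ (0, u) = γ u := by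
  change Ψ.toFun 0 (γ u) = γ u; rw [Ψ.map_zero]; rfl

/-- **The drag identity.**  Let `Ψ` be an ambient isotopy of `M` whose end map returns the circle
`γ` pointwise, `D` a disc bounding `γ` and `F` a stable frame along `γ`.  Then **the extension
class of the transported disc `Ψ₁ ∘ D` equals that of the disc obtained from `D` by inserting the
trace annulus of `γ`**: `e(F, Ψ₁ ∘ D) = e(F, insert(trace Ψ γ, D))`.  (The discs
`Δ_s = insert(trace|[0,s], Ψ_s ∘ D)` all bound `γ`, so their classes agree; `Δ₀ ≃ D`,
`Δ₁ = insert(trace, Ψ₁ ∘ D)`, and the change of class caused by an insertion does not depend on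
the disc, `eClass_insertDisc_add_eClass`.)  Dragging the attaching circle of a 2-handle around a
loop of circles changes its framing class relative to a disc by the class of the inserted trace —
Kirby's way of changing the framing in the odd case (Ch. X p. 56 with Cor. I.4.6).
[cite: Kirby1989, Ch. X pp. 55–56] -/
theorem eClass_compDisc_ambientIsotopy (hm : 2 ≤ m) (Ψ : AmbientIsotopy (𝓡 m) M) (γ : C(𝕊¹, M))
    (hloop : ∀ u, Ψ.toFun 1 (γ u) = γ u) (D : C(𝔻², M)) (hD : ∀ u, D (bd u) = γ u)
    {F : 𝕊¹ → Fr m} (hF : IsStableFrameFieldOn γ F univ) :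
    eClass (compDisc ⟨Ψ.toFun 1, (Ψ.contMDiff_toFun 1).continuous⟩ D) F
        (hF.congr_map fun u _ => by change Ψ.toFun 1 (D (bd u)) = γ u; rw [hD, hloop]) =
      eClass (insertDisc (traceAnnulus Ψ γ) D fun u => (hloop u).trans (hD u).symm) F
        (hF.congr_map fun u _ => by
          change insertDisc (traceAnnulus Ψ γ) D _ (bd u) = γ u; rw [insertDisc_bd, traceAnnulus_zero]) := by
  have hΨc : Continuous (uncurry Ψ.toFun) := Ψ.contMDiff.continuous
  -- the family of discs `Δ_s = insert(trace|[0,s], Ψ_s ∘ D)`, all bounding `γ`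
  set A : I → C(ℝ × 𝕊¹, M) := fun s => ⟨fun q => Ψ.toFun ((s : ℝ) * q.1) (γ q.2),
    hΨc.comp ((continuous_const.mul continuous_fst).prodMk (γ.continuous.comp continuous_snd))⟩ with hAdef
  set X : I → C(𝔻², M) := fun s => ⟨fun x => Ψ.toFun (s : ℝ) (D x),
    hΨc.comp (continuous_const.prodMk D.continuous)⟩ with hXdef
  have hAX : ∀ (s : I) u, A s (1, u) = X s (bd u) := fun s u => by
    change Ψ.toFun ((s : ℝ) * 1) (γ u) = Ψ.toFun (s : ℝ) (D (bd u)); rw [mul_one, hD]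
  have hA0 : ∀ (s : I) u, A s (0, u) = γ u := fun s u => by
    change Ψ.toFun ((s : ℝ) * 0) (γ u) = γ u; rw [mul_zero, Ψ.map_zero]; rfl
  set Δ : I → C(𝔻², M) := fun s => insertDisc (A s) (X s) (hAX s) with hΔdef
  have hΔbd : ∀ (s : I) u, Δ s (bd u) = γ u := fun s u => by rw [hΔdef]; dsimp only; rw [insertDisc_bd, hA0]
  have hΔc : Continuous fun p : I × 𝔻² => Δ p.1 p.2 :=
    continuous_insertFun (Z := I) (A := fun s => A s) (X := fun s => X s)
      (hΨc.comp (((continuous_subtype_val.comp continuous_fst).mul (continuous_fst.comp continuous_snd)).prodMk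
        (γ.continuous.comp (continuous_snd.comp continuous_snd))))
      (hΨc.comp ((continuous_subtype_val.comp continuous_fst).prodMk (D.continuous.comp continuous_snd))) hAX
  -- all `Δ_s` have the same class
  have hFΔ : ∀ s : I, IsStableFrameFieldOn (Δ s ∘ bd) F univ := fun s => hF.congr_map fun u _ => hΔbd s u
  have hsame : eClass (Δ 0) F (hFΔ 0) = eClass (Δ 1) F (hFΔ 1) := by
    have hfr := (framed_glue_iff_of_family (m := m) (D₁ := fun _ => Δ 0) (D₂ := fun s => Δ s)
      ((Δ 0).continuous.comp continuous_snd) hΔc fun s u => (hΔbd 0 u).trans (hΔbd s u).symm).mp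
      (framed_glue_self hm (Δ 0))
    exact (framed_glue_iff hm (Δ 0) (Δ 1) _ (hFΔ 0)).mp hfr
  -- `Δ₁ = insert(trace, Ψ₁ ∘ D)`
  have hΨ1D : X 1 = compDisc ⟨Ψ.toFun 1, (Ψ.contMDiff_toFun 1).continuous⟩ D := by
    ext x; change Ψ.toFun ((1 : I) : ℝ) (D x) = Ψ.toFun 1 (D x); norm_num
  have hA1 : A 1 = traceAnnulus Ψ γ := by
    ext q; change Ψ.toFun (((1 : I) : ℝ) * q.1) (γ q.2) = Ψ.toFun q.1 (γ q.2); norm_num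
  have hΔ1 : Δ 1 = insertDisc (traceAnnulus Ψ γ) (compDisc ⟨Ψ.toFun 1, (Ψ.contMDiff_toFun 1).continuous⟩ D)
      (fun u => by change Ψ.toFun 1 (γ u) = Ψ.toFun 1 (D (bd u)); rw [hD]) := by
    rw [hΔdef]; dsimp only
    have : ∀ (A₁ A₂ : C(ℝ × 𝕊¹, M)) (X₁ X₂ : C(𝔻², M)) (h₁ : ∀ u, A₁ (1, u) = X₁ (bd u)) (h₂ : ∀ u, A₂ (1, u) = X₂ (bd u)),
        A₁ = A₂ → X₁ = X₂ → insertDisc A₁ X₁ h₁ = insertDisc A₂ X₂ h₂ := by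
      intros A₁ A₂ X₁ X₂ h₁ h₂ e₁ e₂; subst e₁ e₂; rfl
    exact this _ _ _ _ _ _ hA1 hΨ1D
  -- `Δ₀ = D ∘ g_{1/2}`
  have hX0 : X 0 = D := by
    ext x; change Ψ.toFun ((0 : I) : ℝ) (D x) = D x; rw [show ((0 : I) : ℝ) = 0 from rfl, Ψ.map_zero]; rfl
  have hA0c : ∀ t u, A 0 (t, u) = (X 0) (bd u) := fun t u => by
    change Ψ.toFun (((0 : I) : ℝ) * t) (γ u) = Ψ.toFun ((0 : I) : ℝ) (D (bd u))
    rw [show ((0 : I) : ℝ) = 0 from rfl, zero_mul, hD]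
  have hΔ0 : Δ 0 = D.comp ⟨halfRadial, continuous_halfRadial⟩ := by
    rw [hΔdef]; dsimp only
    ext x
    rw [insertDisc_const_apply (A 0) (X 0) hA0c x, hX0]; rfl
  have hFD : IsStableFrameFieldOn (D ∘ bd) F univ := hF.congr_map fun u _ => hD u
  have h0 : eClass (Δ 0) F (hFΔ 0) = eClass D F hFD := by
    rw [eClass_congr_disc hΔ0 (hFΔ 0) (hFD.congr_map fun u _ => by
      change D (halfRadial (bd u)) = D (bd u); rw [show halfRadial (bd u) = bd u from Subtype.ext (radial_bd (by norm_num) u)])]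
    exact (framed_glue_iff hm _ D _ _).mp (framed_glue_halfRadial_left hm D)
  -- the insertion changes the class independently of the disc
  have hins := eClass_insertDisc_add_eClass hm (γ := γ) (traceAnnulus Ψ γ) (traceAnnulus_zero Ψ γ) hloop
    (compDisc ⟨Ψ.toFun 1, (Ψ.contMDiff_toFun 1).continuous⟩ D) D
    (fun u => by change Ψ.toFun 1 (D (bd u)) = γ u; rw [hD, hloop]) hD hF
  have h1 : eClass (Δ 1) F (hFΔ 1) = eClass (insertDisc (traceAnnulus Ψ γ)
      (compDisc ⟨Ψ.toFun 1, (Ψ.contMDiff_toFun 1).continuous⟩ D) fun u => (hloop u).trans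
        (show γ u = (compDisc ⟨Ψ.toFun 1, (Ψ.contMDiff_toFun 1).continuous⟩ D) (bd u) by
          change γ u = Ψ.toFun 1 (D (bd u)); rw [hD, hloop])) F
      (hF.congr_map fun u _ => by
        change insertDisc (traceAnnulus Ψ γ) _ _ (bd u) = γ u; rw [insertDisc_bd, traceAnnulus_zero]) :=
    eClass_congr_disc hΔ1 _ _
  rw [← h1, ← hsame, h0] at hins
  have : ∀ a b c : ZMod 2, a + b = c + a → b = c := by decide
  exact this _ _ _ hins

end Drag

end StableFrames

/-! ### 6. The framing class of a tube after dragging its circle around a loop of circles -/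

namespace CircleNbhd

open StableFrames

/-- Local notation: the unit circle. -/
local notation "𝕊¹" => (sphere (0 : EuclideanSpace ℝ (Fin (1 + 1))) 1)

/-- Local notation: the closed unit disc in the plane. -/
local notation "𝔻²" => StableFrames.UnitDisc2

variable {X : Type*} [TopologicalSpace X] [ChartedSpace (EuclideanSpace ℝ (Fin 4)) X] [IsManifold (𝓡 4) ∞ X]
  {c : 𝕊¹ → X} (ν : CircleNbhd (𝓡 4) c)

/-- **Dragging the circle of a framed circle around a loop of circles changes its class relative to
a disc by the class of the inserted trace**: for an ambient isotopy `Ψ` with `Ψ₁ ∘ c = c` and a disc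
`D` bounding `c`, `ob(ν, Ψ₁ ∘ D) = e(tubeFr ν, insert(trace Ψ c, D))`. [cite: Kirby1989, Ch. X pp. 55–56] -/
theorem ob_compDisc_ambientIsotopy (Ψ : AmbientIsotopy (𝓡 4) X) (hc : Continuous c) (hloop : ∀ u, Ψ.toFun 1 (c u) = c u)
    (D : C(𝔻², X)) (hD : ∀ u, D (bd u) = c u) :
    ν.ob (compDisc ⟨Ψ.toFun 1, (Ψ.contMDiff_toFun 1).continuous⟩ D)
        (fun u => by change Ψ.toFun 1 (D (bd u)) = c u; rw [hD, hloop]) =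
      eClass (insertDisc (traceAnnulus Ψ ⟨c, hc⟩) D fun u => (hloop u).trans (hD u).symm) ν.tubeFr
        (ν.isStableFrameFieldOn_tubeFr.congr_map fun u _ => by
          change insertDisc (traceAnnulus Ψ ⟨c, hc⟩) D _ (bd u) = c u; rw [insertDisc_bd, traceAnnulus_zero]; rfl) :=
  eClass_compDisc_ambientIsotopy (by norm_num) Ψ ⟨c, hc⟩ hloop D hD ν.isStableFrameFieldOn_tubeFr

end CircleNbhd

end Literature.Topology.FourManifolds
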